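import Literature.Analysis.ODE.HeunEulerIntegrals
import HarnessLib

/-!
# The one-sided Euler transform of a function with an algebraic branch point: the branch of the
# transform at the base point, gluing across the far endpoint, regularity of Heun solutions

Topic `Literature/Analysis/ODE` (namespace `Literature.Analysis.ODE`, sub-namespace `GeneralHeun`;
continues `HeunEulerIntegrals.lean`).

For `v(w) = (w−1)^ρ h(w)` near `w = 1⁺` (`h` smooth on a TWO-sided neighbourhood of `1`,
`Re ρ > −1`) the one-sided Euler / Riemann–Liouville transform
`Φ_κ[v](z) = (z−1)^{1−κ} ∫₀¹ (1−t)^{−κ} v(1+(z−1)t) dt` (`Re κ < 1`) factors as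
`Φ_κ[v](z) = (z−1)^{1−κ+ρ} H(z)`, `H(z) = ∫₀¹ (1−t)^{−κ} t^ρ h(1+(z−1)t) dt`,
and `H` is smooth on a two-sided neighbourhood of `1` (differentiation under the integral sign
against the fixed Beta weight `t^{Re ρ}(1−t)^{−Re κ}`). Consequently every `z`-derivative
`∂_z^k Φ_κ[v]` is `(z−1)^{1−κ+ρ−k}` times a smooth function on a two-sided neighbourhood of `1`
(Leibniz' rule) — the branch exponent `ρ + 1 − θ` of the (derivative-regularised) Euler
transform with kernel exponent `θ = κ + k` (K. Takemura, [Takemura2017] Prop. 1.2 and the remark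
following it, for the real one-sided path; classical for Riemann–Liouville integrals,
[SamkoKilbasMarichev1993] §2.5).

Also PROVED here, for the use of the transform on solutions of Heun's equation on `(1, a_H)`:
* classical solutions of `M_z(γ,δ,ε;α,β;q) v = 0` on an open interval avoiding the singular points
  are smooth there (bootstrapping);
* gluing: a solution on `(1, z₂)` that agrees near `z₂⁻` with a function smooth across `z₂`
  extends to a smooth function on `(1, z₂ + e)`, with the same chart at `1`;
* such a function satisfies the derivative bounds `EulerBound` of `HeunEulerIntegrals.lean`
  (`‖ṽ⁽ʲ⁾(w)‖ ≤ C_j (w−1)^{Re ρ − j}`).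

No named facts are introduced.

## References
* K. Takemura, J. Math. Soc. Japan 69 (2017) 849–891, Prop. 1.2. Key `Takemura2017`.
* S. G. Samko, A. A. Kilbas, O. I. Marichev, *Fractional integrals and derivatives*, Gordon and
  Breach 1993, §2.5 (images of power-type functions). Key `SamkoKilbasMarichev1993`.
-/

noncomputable section

open Set Filter MeasureTheory intervalIntegral
open scoped Topology Interval

namespace Literature.Analysis.ODE

namespace GeneralHeun

/-! ### Smooth functions on an open set: the chain of iterated derivatives -/

/-- On an open set, the iterated derivatives of a smooth function form a chain of honest
derivatives. [folklore] -/
private theorem hasDerivAt_iteratedDeriv_of_contDiffOn' {f : ℝ → ℂ} {U : Set ℝ} (hU : IsOpen U)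
    (hf : ContDiffOn ℝ ((⊤ : ℕ∞) : WithTop ℕ∞) f U) (j : ℕ) {w : ℝ} (hw : w ∈ U) :
    HasDerivAt (iteratedDeriv j f) (iteratedDeriv (j + 1) f w) w := by
  have hdiff : DifferentiableOn ℝ (iteratedDerivWithin j f U) U :=
    hf.differentiableOn_iteratedDerivWithin (WithTop.coe_lt_coe.2 (ENat.coe_lt_top j))
      hU.uniqueDiffOn
  have heq : iteratedDerivWithin j f U =ᶠ[𝓝 w] iteratedDeriv j f := by
    filter_upwards [hU.mem_nhds hw] with x hx using iteratedDerivWithin_of_isOpen hU hx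
  have h1 : DifferentiableAt ℝ (iteratedDeriv j f) w :=
    ((hdiff w hw).differentiableAt (hU.mem_nhds hw)).congr_of_eventuallyEq heq.symm
  rw [iteratedDeriv_succ]
  exact h1.hasDerivAt

/-- The iterated derivatives of a smooth function on an open set are continuous there.
[folklore] -/
private theorem continuousOn_iteratedDeriv_of_contDiffOn' {f : ℝ → ℂ} {U : Set ℝ} (hU : IsOpen U)
    (hf : ContDiffOn ℝ ((⊤ : ℕ∞) : WithTop ℕ∞) f U) (j : ℕ) :
    ContinuousOn (iteratedDeriv j f) U := fun _ hw =>
  (hasDerivAt_iteratedDeriv_of_contDiffOn' hU hf j hw).continuousAt.continuousWithinAt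

/-- On an open set, the `j`-th iterated derivative of a smooth function is smooth. [folklore] -/
private theorem contDiffOn_iteratedDeriv_of_contDiffOn' {f : ℝ → ℂ} {U : Set ℝ} (hU : IsOpen U)
    (hf : ContDiffOn ℝ ((⊤ : ℕ∞) : WithTop ℕ∞) f U) (j : ℕ) :
    ContDiffOn ℝ ((⊤ : ℕ∞) : WithTop ℕ∞) (iteratedDeriv j f) U := by
  induction j with
  | zero => simpa using hf
  | succ j ih =>
    rw [iteratedDeriv_succ]
    exact ih.deriv_of_isOpen hU (by norm_cast)

/-- A smooth function on an open set agrees near each point with its `ContDiffAt` germ.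
[folklore] -/
private theorem contDiffAt_of_contDiffOn' {f : ℝ → ℂ} {U : Set ℝ} (hU : IsOpen U)
    (hf : ContDiffOn ℝ ((⊤ : ℕ∞) : WithTop ℕ∞) f U) {n : WithTop ℕ∞} (hn : n ≤ ((⊤ : ℕ∞) : WithTop ℕ∞))
    {w : ℝ} (hw : w ∈ U) :
    ContDiffAt ℝ n f w :=
  ((hf.of_le hn).contDiffWithinAt hw).contDiffAt (hU.mem_nhds hw)

/-! ### The shifted power `(w−1)^s` -/

/-- Coefficient of the `n`-th derivative of a power: `s(s−1)⋯(s−n+1)` (`= Γ(s+1)/Γ(s−n+1)`).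
[cite: SamkoKilbasMarichev1993, §2.5 (2.26)] -/
def powDerivCoeff (s : ℂ) : ℕ → ℂ
  | 0 => 1
  | n + 1 => powDerivCoeff s n * (s - n)

/-- Derivative of `w ↦ (w−1)^s` at `w > 1`: `s (w−1)^{s−1}`. [folklore] -/
private theorem hasDerivAt_sub_one_cpow (s : ℂ) {w : ℝ} (hw : 1 < w) :
    HasDerivAt (fun y : ℝ => ((y - 1 : ℝ) : ℂ) ^ s) (s * ((w - 1 : ℝ) : ℂ) ^ (s - 1)) w := by
  have hw1 : w - 1 ≠ 0 := (sub_pos.mpr hw).ne'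
  rcases eq_or_ne s 0 with rfl | hs
  · simp only [Complex.cpow_zero, zero_mul]
    exact hasDerivAt_const w 1
  · have h2 : HasDerivAt (fun y : ℝ => y - 1) 1 w := (hasDerivAt_id w).sub_const 1
    have h1 : HasDerivAt (fun y : ℝ => (y : ℂ) ^ s) (s * ((w - 1 : ℝ) : ℂ) ^ (s - 1))
        ((fun y : ℝ => y - 1) w) :=
      hasDerivAt_ofReal_cpow_const hw1 hs
    have h3 := h1.scomp w h2
    rw [one_smul] at h3
    exact h3

/-- `dⁿ/dwⁿ (w−1)^s = s(s−1)⋯(s−n+1) (w−1)^{s−n}` for `w > 1` (integer-order case of the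
Riemann–Liouville derivative of a power). [cite: SamkoKilbasMarichev1993, §2.5 (2.26)] -/
theorem iteratedDeriv_sub_one_cpow (s : ℂ) (n : ℕ) {w : ℝ} (hw : 1 < w) :
    iteratedDeriv n (fun y : ℝ => ((y - 1 : ℝ) : ℂ) ^ s) w =
      powDerivCoeff s n * ((w - 1 : ℝ) : ℂ) ^ (s - n) := by
  induction n generalizing w with
  | zero => simp [powDerivCoeff]
  | succ n ih =>
    rw [iteratedDeriv_succ]
    have hloc : iteratedDeriv n (fun y : ℝ => ((y - 1 : ℝ) : ℂ) ^ s) =ᶠ[𝓝 w]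
        fun y : ℝ => powDerivCoeff s n * ((y - 1 : ℝ) : ℂ) ^ (s - n) := by
      filter_upwards [Ioi_mem_nhds hw] with u hu using ih hu
    rw [hloc.deriv_eq, ((hasDerivAt_sub_one_cpow (s - n) hw).const_mul (powDerivCoeff s n)).deriv]
    simp only [powDerivCoeff]
    push_cast
    ring_nf

/-- `w ↦ (w−1)^s` is smooth at every `w > 1` (as a map `ℝ → ℂ`). [folklore] -/
private theorem contDiffAt_sub_one_cpow (s : ℂ) {n : WithTop ℕ∞} {w : ℝ} (hw : 1 < w) :
    ContDiffAt ℝ n (fun y : ℝ => ((y - 1 : ℝ) : ℂ) ^ s) w := by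
  have h1 : AnalyticAt ℂ (fun z : ℂ => z ^ s) ((w - 1 : ℝ) : ℂ) :=
    analyticAt_id.cpow analyticAt_const (Complex.ofReal_mem_slitPlane.2 (sub_pos.mpr hw))
  have h2 : AnalyticAt ℝ (fun u : ℝ => (u : ℂ)) (w - 1) := Complex.ofRealCLM.analyticAt (w - 1)
  have h3 : AnalyticAt ℝ (fun y : ℝ => y - 1) w := analyticAt_id.sub analyticAt_const
  have h4 : AnalyticAt ℝ (fun y : ℝ => ((y - 1 : ℝ) : ℂ)) w :=
    AnalyticAt.comp (g := fun u : ℝ => (u : ℂ)) (f := fun y : ℝ => y - 1) h2 h3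
  have h5 : AnalyticAt ℝ (fun y : ℝ => ((y - 1 : ℝ) : ℂ) ^ s) w :=
    AnalyticAt.comp (g := fun z : ℂ => z ^ s) (f := fun y : ℝ => ((y - 1 : ℝ) : ℂ))
      h1.restrictScalars h4
  exact h5.contDiffAt

/-! ### The two-sided branch integral `H_{κ,ρ,j}[h](z) = ∫₀¹ (1−t)^{−κ} t^ρ tʲ h⁽ʲ⁾(1+(z−1)t) dt` -/

/-- Integrand of the branch integral: `(1−t)^{−κ} · t^ρ · tʲ h⁽ʲ⁾(1+(z−1)t)`.
[cite: SamkoKilbasMarichev1993, §2.5 (2.44)] -/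
def branchIntegrand (κ ρ : ℂ) (h : ℝ → ℂ) (j : ℕ) (z t : ℝ) : ℂ :=
  eulerKernel κ (1 - t) * ((t : ℂ) ^ ρ * ((t : ℂ) ^ j * iteratedDeriv j h (eulerPt z t)))

/-- The branch integral `H_{κ,ρ,j}[h](z) = ∫₀¹ (1−t)^{−κ} t^ρ tʲ h⁽ʲ⁾(1+(z−1)t) dt`; for `j = 0`,
`Φ_κ[(w−1)^ρ h](z) = (z−1)^{1−κ+ρ} H_{κ,ρ,0}[h](z)`. [cite: SamkoKilbasMarichev1993, §2.5 (2.44)] -/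
def branchIntegral (κ ρ : ℂ) (h : ℝ → ℂ) (j : ℕ) (z : ℝ) : ℂ :=
  ∫ t in (0 : ℝ)..1, branchIntegrand κ ρ h j z t

/-- For `z ∈ (1−e, 1+e)` and `t ∈ [0,1]`, the point `1 + (z−1)t` lies in `(1−e, 1+e)` (it lies
between `1` and `z`). [folklore] -/
private theorem eulerPt_mem_twoSided {e z t : ℝ} (hz : z ∈ Ioo (1 - e) (1 + e))
    (ht : t ∈ Icc (0 : ℝ) 1) : eulerPt z t ∈ Ioo (1 - e) (1 + e) := by
  unfold eulerPt
  obtain ⟨hz1, hz2⟩ := hz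
  obtain ⟨ht0, ht1⟩ := ht
  constructor
  · nlinarith
  · nlinarith

/-- `eulerPt z t` lies between `1` and `z`: in `[min 1 z, max 1 z]`, for `t ∈ [0,1]`. [folklore] -/
private theorem eulerPt_mem_Icc_min_max {z t : ℝ} (ht : t ∈ Icc (0 : ℝ) 1) :
    eulerPt z t ∈ Icc (min 1 z) (max 1 z) := by
  unfold eulerPt
  obtain ⟨ht0, ht1⟩ := ht
  constructor
  · rcases le_or_gt 1 z with h | h
    · rw [min_eq_left h]; nlinarith
    · rw [min_eq_right h.le]; nlinarith
  · rcases le_or_gt 1 z with h | h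
    · rw [max_eq_right h]; nlinarith
    · rw [max_eq_left h.le]; nlinarith

/-- The branch integrand is continuous in `t` on `(0,1)` for `z ∈ (1−e,1+e)`, `h` smooth on
`(1−e,1+e)`. [cite: SamkoKilbasMarichev1993, §2.5] -/
theorem continuousOn_branchIntegrand {h : ℝ → ℂ} {e : ℝ}
    (hh : ContDiffOn ℝ ((⊤ : ℕ∞) : WithTop ℕ∞) h (Ioo (1 - e) (1 + e))) (κ ρ : ℂ) (j : ℕ)
    {z : ℝ} (hz : z ∈ Ioo (1 - e) (1 + e)) :
    ContinuousOn (branchIntegrand κ ρ h j z) (Ioo 0 1) := by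
  unfold branchIntegrand
  refine ContinuousOn.mul ((continuousOn_eulerKernel_one_sub κ).mono fun t ht => ht.2) ?_
  refine ContinuousOn.mul ?_ (ContinuousOn.mul (Complex.continuous_ofReal.continuousOn.pow j) ?_)
  · intro t ht
    exact (Complex.continuousAt_ofReal_cpow_const _ _ (Or.inr ht.1.ne')).continuousWithinAt
  · have hcont := continuousOn_iteratedDeriv_of_contDiffOn' isOpen_Ioo hh j
    refine hcont.comp ?_ ?_
    · unfold eulerPt
      exact (continuousOn_const.add (continuousOn_const.mul continuousOn_id))
    · intro t ht
      exact eulerPt_mem_twoSided hz ⟨ht.1.le, ht.2.le⟩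

/-- The branch integrand is a.e.-strongly measurable on `Ι 0 1`. [cite: SamkoKilbasMarichev1993, §2.5] -/
theorem aestronglyMeasurable_branchIntegrand {h : ℝ → ℂ} {e : ℝ}
    (hh : ContDiffOn ℝ ((⊤ : ℕ∞) : WithTop ℕ∞) h (Ioo (1 - e) (1 + e))) (κ ρ : ℂ) (j : ℕ)
    {z : ℝ} (hz : z ∈ Ioo (1 - e) (1 + e)) :
    AEStronglyMeasurable (branchIntegrand κ ρ h j z) (volume.restrict (Ι (0 : ℝ) 1)) := by
  rw [uIoc_of_le zero_le_one, ← Measure.restrict_congr_set Ioo_ae_eq_Ioc]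
  exact (continuousOn_branchIntegrand hh κ ρ j hz).aestronglyMeasurable measurableSet_Ioo

/-- **Pointwise majorant.** If `‖h⁽ʲ⁾‖ ≤ M` on `[min 1 z, max 1 z]`, then for `0 < t < 1`
`‖(1−t)^{−κ} t^ρ tʲ h⁽ʲ⁾(1+(z−1)t)‖ ≤ M · t^{Re ρ} (1−t)^{−Re κ}`. [cite: SamkoKilbasMarichev1993, §2.5] -/
theorem norm_branchIntegrand_le {h : ℝ → ℂ} {j : ℕ} {M : ℝ} (κ ρ : ℂ)
    {z : ℝ} (hM : ∀ w ∈ Icc (min 1 z) (max 1 z), ‖iteratedDeriv j h w‖ ≤ M) {t : ℝ}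
    (ht : t ∈ Ioo (0 : ℝ) 1) :
    ‖branchIntegrand κ ρ h j z t‖ ≤ M * (t ^ ρ.re * (1 - t) ^ (-κ.re)) := by
  have ht0 : 0 < t := ht.1
  have ht1 : 0 < 1 - t := sub_pos.mpr ht.2
  have hb := hM _ (eulerPt_mem_Icc_min_max ⟨ht.1.le, ht.2.le⟩)
  have hM0 : 0 ≤ M := (norm_nonneg _).trans hb
  unfold branchIntegrand
  rw [norm_mul, norm_mul, norm_mul, norm_eulerKernel κ ht1, Complex.norm_cpow_eq_rpow_re_of_pos ht0,
    norm_pow, Complex.norm_real, Real.norm_eq_abs, abs_of_pos ht0]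
  have htj : t ^ j ≤ 1 := pow_le_one₀ ht0.le ht.2.le
  have h1 : t ^ j * ‖iteratedDeriv j h (eulerPt z t)‖ ≤ M := by
    calc t ^ j * ‖iteratedDeriv j h (eulerPt z t)‖ ≤ 1 * M :=
          mul_le_mul htj hb (norm_nonneg _) zero_le_one
      _ = M := one_mul M
  have hnn1 : 0 ≤ (1 - t) ^ (-κ.re) := Real.rpow_nonneg ht1.le _
  have hnn2 : 0 ≤ t ^ ρ.re := Real.rpow_nonneg ht0.le _
  calc (1 - t) ^ (-κ.re) * (t ^ ρ.re * (t ^ j * ‖iteratedDeriv j h (eulerPt z t)‖))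
      ≤ (1 - t) ^ (-κ.re) * (t ^ ρ.re * M) := by gcongr
    _ = M * (t ^ ρ.re * (1 - t) ^ (-κ.re)) := by ring

/-- A uniform bound for `h⁽ʲ⁾` on the segments `[min 1 x, max 1 x]`, `x` in a compact
subinterval `[z−d, z+d] ⊂ (1−e, 1+e)`. [folklore] -/
private theorem exists_bound_iteratedDeriv {h : ℝ → ℂ} {e : ℝ}
    (hh : ContDiffOn ℝ ((⊤ : ℕ∞) : WithTop ℕ∞) h (Ioo (1 - e) (1 + e))) (j : ℕ) {z d : ℝ}
    (hd1 : 1 - e < z - d) (hd2 : z + d < 1 + e) (he : 1 - e < 1 ∧ 1 < 1 + e) :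
    ∃ M : ℝ, ∀ x ∈ Icc (z - d) (z + d), ∀ w ∈ Icc (min 1 x) (max 1 x), ‖iteratedDeriv j h w‖ ≤ M := by
  -- the compact set `K = [min 1 (z−d), max 1 (z+d)] ⊂ (1−e, 1+e)` contains all these segments
  set K := Icc (min 1 (z - d)) (max 1 (z + d)) with hK
  have hKsub : K ⊆ Ioo (1 - e) (1 + e) := by
    intro w hw
    constructor
    · have : 1 - e < min 1 (z - d) := lt_min he.1 hd1
      exact this.trans_le hw.1
    · have : max 1 (z + d) < 1 + e := max_lt he.2 hd2
      exact lt_of_le_of_lt hw.2 this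
  obtain ⟨M, hM⟩ := IsCompact.exists_bound_of_continuousOn isCompact_Icc
    ((continuousOn_iteratedDeriv_of_contDiffOn' isOpen_Ioo hh j).mono hKsub)
  refine ⟨M, fun x hx w hw => hM w ⟨?_, ?_⟩⟩
  · exact (min_le_min le_rfl hx.1).trans hw.1
  · exact hw.2.trans (max_le_max le_rfl hx.2)

/-- **Absolute convergence of the branch integral.** [cite: SamkoKilbasMarichev1993, §2.5] -/
theorem intervalIntegrable_branchIntegrand {h : ℝ → ℂ} {e : ℝ}
    (hh : ContDiffOn ℝ ((⊤ : ℕ∞) : WithTop ℕ∞) h (Ioo (1 - e) (1 + e))) {κ ρ : ℂ}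
    (hκ : κ.re < 1) (hρ : -1 < ρ.re) (j : ℕ) {z : ℝ} (hz : z ∈ Ioo (1 - e) (1 + e)) :
    IntervalIntegrable (branchIntegrand κ ρ h j z) volume 0 1 := by
  have he : 1 - e < 1 ∧ 1 < 1 + e := ⟨by linarith [hz.1, hz.2], by linarith [hz.1, hz.2]⟩
  obtain ⟨M, hM⟩ := exists_bound_iteratedDeriv hh j (z := z) (d := 0) (by simpa using hz.1)
    (by simpa using hz.2) he
  have hMz := hM z ⟨by simp, by simp⟩
  have hmaj := (intervalIntegrable_rpow_mul_one_sub_rpow hρ (by linarith : -1 < -κ.re)).const_mul M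
  refine hmaj.mono_fun' (aestronglyMeasurable_branchIntegrand hh κ ρ j hz) ?_
  rw [uIoc_of_le zero_le_one]
  rw [Filter.EventuallyLE, ae_restrict_iff' measurableSet_Ioc]
  have h1 : ∀ᵐ t : ℝ ∂volume, t ≠ 1 := by
    have : ({1}ᶜ : Set ℝ) ∈ ae volume := by
      rw [compl_mem_ae_iff]; exact measure_singleton 1
    filter_upwards [this] with t ht using ht
  filter_upwards [h1] with t ht1 ht
  have ht' : t ∈ Ioo (0 : ℝ) 1 := ⟨ht.1, lt_of_le_of_ne ht.2 ht1⟩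
  exact norm_branchIntegrand_le κ ρ hMz ht'

/-- **Differentiation under the integral sign, two-sided in `z`:**
`d/dz H_{κ,ρ,j}[h] = H_{κ,ρ,j+1}[h]` on `(1−e, 1+e)` (`Re κ < 1`, `Re ρ > −1`, `h` smooth on
`(1−e,1+e)`; dominated convergence with the fixed Beta majorant `t^{Re ρ}(1−t)^{−Re κ}`).
[cite: SamkoKilbasMarichev1993, §2.5] -/
theorem hasDerivAt_branchIntegral {h : ℝ → ℂ} {e : ℝ}
    (hh : ContDiffOn ℝ ((⊤ : ℕ∞) : WithTop ℕ∞) h (Ioo (1 - e) (1 + e))) {κ ρ : ℂ}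
    (hκ : κ.re < 1) (hρ : -1 < ρ.re) (j : ℕ) {z : ℝ} (hz : z ∈ Ioo (1 - e) (1 + e)) :
    HasDerivAt (branchIntegral κ ρ h j) (branchIntegral κ ρ h (j + 1) z) z := by
  have he : 1 - e < 1 ∧ 1 < 1 + e := ⟨by linarith [hz.1, hz.2], by linarith [hz.1, hz.2]⟩
  -- a neighbourhood `(z−d, z+d)` with closure inside `(1−e, 1+e)`
  set d : ℝ := min (z - (1 - e)) ((1 + e) - z) / 2 with hd
  have hd0 : 0 < d := by
    rw [hd]; have := lt_min (sub_pos.mpr hz.1) (sub_pos.mpr hz.2); linarith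
  have hd1 : 1 - e < z - d := by
    have : min (z - (1 - e)) ((1 + e) - z) ≤ z - (1 - e) := min_le_left _ _
    rw [hd]; linarith
  have hd2 : z + d < 1 + e := by
    have : min (z - (1 - e)) ((1 + e) - z) ≤ (1 + e) - z := min_le_right _ _
    rw [hd]; linarith
  set s : Set ℝ := Ioo (z - d) (z + d) with hs_def
  have hs : s ∈ 𝓝 z := Ioo_mem_nhds (by linarith) (by linarith)
  have hsub : ∀ x ∈ s, x ∈ Ioo (1 - e) (1 + e) := fun x hx => ⟨hd1.trans hx.1, hx.2.trans hd2⟩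
  obtain ⟨M, hM⟩ := exists_bound_iteratedDeriv hh (j + 1) hd1 hd2 he
  have key := intervalIntegral.hasDerivAt_integral_of_dominated_loc_of_deriv_le
    (μ := volume) (a := 0) (b := 1) (F := fun ζ t => branchIntegrand κ ρ h j ζ t)
    (F' := fun ζ t => branchIntegrand κ ρ h (j + 1) ζ t) (x₀ := z) (s := s)
    (bound := fun t => M * (t ^ ρ.re * (1 - t) ^ (-κ.re))) hs ?_ ?_ ?_ ?_ ?_ ?_
  · exact key.2
  · filter_upwards [hs] with x hx
    exact aestronglyMeasurable_branchIntegrand hh κ ρ j (hsub x hx)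
  · exact intervalIntegrable_branchIntegrand hh hκ hρ j hz
  · exact aestronglyMeasurable_branchIntegrand hh κ ρ (j + 1) hz
  · have h1 : ∀ᵐ t : ℝ ∂volume, t ≠ 1 := by
      have : ({1}ᶜ : Set ℝ) ∈ ae volume := by
        rw [compl_mem_ae_iff]; exact measure_singleton 1
      filter_upwards [this] with t ht using ht
    filter_upwards [h1] with t ht1 ht x hx
    rw [uIoc_of_le zero_le_one] at ht
    have ht' : t ∈ Ioo (0 : ℝ) 1 := ⟨ht.1, lt_of_le_of_ne ht.2 ht1⟩
    exact norm_branchIntegrand_le κ ρ (hM x ⟨hx.1.le, hx.2.le⟩) ht'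
  · exact (intervalIntegrable_rpow_mul_one_sub_rpow hρ (by linarith : -1 < -κ.re)).const_mul _
  · refine Eventually.of_forall fun t ht x hx => ?_
    rw [uIoc_of_le zero_le_one] at ht
    have hw : eulerPt x t ∈ Ioo (1 - e) (1 + e) := eulerPt_mem_twoSided (hsub x hx) ⟨ht.1.le, ht.2⟩
    have hD := (hasDerivAt_iteratedDeriv_of_contDiffOn' isOpen_Ioo hh j hw).scomp x
      (hasDerivAt_eulerPt_z x t)
    have h := ((hD.const_mul ((t : ℂ) ^ j)).const_mul ((t : ℂ) ^ ρ)).const_mul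
      (eulerKernel κ (1 - t))
    unfold branchIntegrand
    refine h.congr_deriv ?_
    rw [Complex.real_smul]
    ring

/-- `d/dz H_{κ,ρ,j}[h] = H_{κ,ρ,j+1}[h]` as an equation for `deriv`. [cite: SamkoKilbasMarichev1993, §2.5] -/
theorem deriv_branchIntegral {h : ℝ → ℂ} {e : ℝ}
    (hh : ContDiffOn ℝ ((⊤ : ℕ∞) : WithTop ℕ∞) h (Ioo (1 - e) (1 + e))) {κ ρ : ℂ}
    (hκ : κ.re < 1) (hρ : -1 < ρ.re) (j : ℕ) {z : ℝ} (hz : z ∈ Ioo (1 - e) (1 + e)) :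
    deriv (branchIntegral κ ρ h j) z = branchIntegral κ ρ h (j + 1) z :=
  (hasDerivAt_branchIntegral hh hκ hρ j hz).deriv

/-- **All orders.** `iteratedDeriv m H_{κ,ρ,j}[h] = H_{κ,ρ,j+m}[h]` on `(1−e, 1+e)`.
[cite: SamkoKilbasMarichev1993, §2.5] -/
theorem iteratedDeriv_branchIntegral {h : ℝ → ℂ} {e : ℝ}
    (hh : ContDiffOn ℝ ((⊤ : ℕ∞) : WithTop ℕ∞) h (Ioo (1 - e) (1 + e))) {κ ρ : ℂ}
    (hκ : κ.re < 1) (hρ : -1 < ρ.re) (m j : ℕ) {z : ℝ} (hz : z ∈ Ioo (1 - e) (1 + e)) :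
    iteratedDeriv m (branchIntegral κ ρ h j) z = branchIntegral κ ρ h (j + m) z := by
  induction m generalizing z with
  | zero => simp
  | succ m ih =>
    rw [iteratedDeriv_succ]
    have hloc : iteratedDeriv m (branchIntegral κ ρ h j) =ᶠ[𝓝 z] branchIntegral κ ρ h (j + m) := by
      filter_upwards [Ioo_mem_nhds hz.1 hz.2] with x hx using ih hx
    rw [hloc.deriv_eq, deriv_branchIntegral hh hκ hρ (j + m) hz, Nat.add_assoc]

/-- **Two-sided smoothness of the branch integral.** `z ↦ H_{κ,ρ,j}[h](z)` is `C^∞` on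
`(1−e, 1+e)`. [cite: SamkoKilbasMarichev1993, §2.5] -/
theorem contDiffOn_branchIntegral {h : ℝ → ℂ} {e : ℝ}
    (hh : ContDiffOn ℝ ((⊤ : ℕ∞) : WithTop ℕ∞) h (Ioo (1 - e) (1 + e))) {κ ρ : ℂ}
    (hκ : κ.re < 1) (hρ : -1 < ρ.re) (j : ℕ) :
    ContDiffOn ℝ ((⊤ : ℕ∞) : WithTop ℕ∞) (branchIntegral κ ρ h j) (Ioo (1 - e) (1 + e)) := by
  have hdiff : ∀ j, DifferentiableOn ℝ (branchIntegral κ ρ h j) (Ioo (1 - e) (1 + e)) :=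
    fun j z hz => (hasDerivAt_branchIntegral hh hκ hρ j hz).differentiableAt.differentiableWithinAt
  have hnat : ∀ n : ℕ, ∀ j, ContDiffOn ℝ (n : WithTop ℕ∞) (branchIntegral κ ρ h j)
      (Ioo (1 - e) (1 + e)) := by
    intro n
    induction n with
    | zero => exact fun j => contDiffOn_zero.2 (hdiff j).continuousOn
    | succ n ih =>
      intro j
      have h := (contDiffOn_succ_iff_deriv_of_isOpen (𝕜 := ℝ) (n := (n : WithTop ℕ∞))
        (f := branchIntegral κ ρ h j) isOpen_Ioo).2 ⟨hdiff j, fun h => absurd h (by simp), ?_⟩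
      · exact_mod_cast h
      · exact (ih (j + 1)).congr fun z hz => deriv_branchIntegral hh hκ hρ j hz
  exact contDiffOn_infty.2 fun n => hnat n j

/-! ### The branch of the Euler transform at the base point -/

/-- **Factorisation of the transform of branch data.** If `v(w) = (w−1)^ρ h(w)` on `(1, 1+e)`,
then for `1 < z < 1+e`: `Ψ_{κ,0}[v](z) = (z−1)^ρ · H_{κ,ρ,0}[h](z)`, i.e.
`∫₀¹ (1−t)^{−κ} v(1+(z−1)t) dt = (z−1)^ρ ∫₀¹ (1−t)^{−κ} t^ρ h(1+(z−1)t) dt`.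
[cite: SamkoKilbasMarichev1993, §2.5 (2.44)] -/
theorem eulerΨ_zero_eq_cpow_mul_branchIntegral {h v : ℝ → ℂ} {e : ℝ} (κ ρ : ℂ)
    (hv : ∀ w ∈ Ioo 1 (1 + e), v w = ((w - 1 : ℝ) : ℂ) ^ ρ * h w) {z : ℝ} (hz : z ∈ Ioo 1 (1 + e)) :
    eulerΨ κ v 0 z = ((z - 1 : ℝ) : ℂ) ^ ρ * branchIntegral κ ρ h 0 z := by
  unfold eulerΨ branchIntegral
  rw [← intervalIntegral.integral_const_mul]
  refine intervalIntegral.integral_congr_ae (Eventually.of_forall fun t ht => ?_)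
  rw [uIoc_of_le zero_le_one] at ht
  have hz1 : 0 < z - 1 := sub_pos.mpr hz.1
  have hw : eulerPt z t ∈ Ioo 1 (1 + e) := by
    have h := eulerPt_mem_Ioc hz.1 ht
    exact ⟨h.1, lt_of_le_of_lt h.2 hz.2⟩
  unfold eulerΨIntegrand branchIntegrand
  simp only [pow_zero, one_mul, iteratedDeriv_zero]
  rw [hv _ hw, eulerPt_sub_one, Complex.ofReal_mul, Complex.mul_cpow_ofReal_nonneg hz1.le ht.1.le]
  ring

/-- **The transform of branch data is a power times a two-sided smooth function:** for
`v(w) = (w−1)^ρ h(w)` on `(1,1+e)` and `1 < z < 1+e`,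
`Φ_κ[v](z) = (z−1)^{1−κ} Ψ_{κ,0}[v](z) = (z−1)^{1−κ+ρ} H_{κ,ρ,0}[h](z)`.
[cite: SamkoKilbasMarichev1993, §2.5 (2.44)] -/
theorem eulerTransform_eq_cpow_mul_branchIntegral {h v : ℝ → ℂ} {e : ℝ} (κ ρ : ℂ)
    (hv : ∀ w ∈ Ioo 1 (1 + e), v w = ((w - 1 : ℝ) : ℂ) ^ ρ * h w) {z : ℝ} (hz : z ∈ Ioo 1 (1 + e)) :
    eulerKernel (κ - 1) (z - 1) * eulerΨ κ v 0 z =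
      ((z - 1 : ℝ) : ℂ) ^ (1 - κ + ρ) * branchIntegral κ ρ h 0 z := by
  have hz1 : 0 < z - 1 := sub_pos.mpr hz.1
  have hne : ((z - 1 : ℝ) : ℂ) ≠ 0 := by exact_mod_cast hz1.ne'
  rw [eulerΨ_zero_eq_cpow_mul_branchIntegral κ ρ hv hz, eulerKernel_eq_cpow (κ - 1) hz1, ← mul_assoc,
    ← Complex.cpow_add _ _ hne]
  congr 2
  ring

/-- The smooth cofactor of `∂_z^k Φ_κ[(w−1)^ρ h]` at the base point:
`Ĥ_k(z) = Σ_{i≤k} C(k,i) s(s−1)⋯(s−i+1) (z−1)^{k−i} H_{κ,ρ,k−i}[h](z)`, `s = 1−κ+ρ`.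
[cite: SamkoKilbasMarichev1993, §2.5 (2.44)] -/
def branchCofactor (κ ρ : ℂ) (h : ℝ → ℂ) (k : ℕ) (z : ℝ) : ℂ :=
  ∑ i ∈ Finset.range (k + 1), (k.choose i : ℂ) * powDerivCoeff (1 - κ + ρ) i *
    ((z - 1 : ℝ) : ℂ) ^ (k - i) * branchIntegral κ ρ h (k - i) z

/-- The cofactor `Ĥ_k` is smooth on the two-sided neighbourhood `(1−e, 1+e)`.
[cite: SamkoKilbasMarichev1993, §2.5] -/
theorem contDiffOn_branchCofactor {h : ℝ → ℂ} {e : ℝ}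
    (hh : ContDiffOn ℝ ((⊤ : ℕ∞) : WithTop ℕ∞) h (Ioo (1 - e) (1 + e))) {κ ρ : ℂ}
    (hκ : κ.re < 1) (hρ : -1 < ρ.re) (k : ℕ) :
    ContDiffOn ℝ ((⊤ : ℕ∞) : WithTop ℕ∞) (branchCofactor κ ρ h k) (Ioo (1 - e) (1 + e)) := by
  unfold branchCofactor
  refine ContDiffOn.sum fun i _ => ?_
  have hp : ContDiff ℝ ((⊤ : ℕ∞) : WithTop ℕ∞) (fun z : ℝ => ((z - 1 : ℝ) : ℂ) ^ (k - i)) :=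
    (Complex.ofRealCLM.contDiff.comp (contDiff_id.sub contDiff_const)).pow _
  exact ((contDiffOn_const.mul hp.contDiffOn).mul (contDiffOn_branchIntegral hh hκ hρ (k - i)))

/-- **The branch of the (derivative-regularised) Euler transform at the base point.** If
`v(w) = (w−1)^ρ h(w)` on `(1,1+e)` with `h` smooth on `(1−e,1+e)`, `Re ρ > −1`, `Re κ < 1`, then
for every `k` and `1 < z < 1+e`:
`∂_z^k Φ_κ[v](z) = (z−1)^{1−κ+ρ−k} · Ĥ_k(z)` with `Ĥ_k = branchCofactor κ ρ h k` smooth on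
`(1−e, 1+e)` — the target branch exponent `ρ + 1 − θ`, `θ = κ + k`.
[cite: Takemura2017, Proposition 1.2 (remark: exponents of the transformed solution)] -/
theorem iteratedDeriv_eulerTransform_eq_cpow_mul_branchCofactor {h v : ℝ → ℂ} {e : ℝ}
    (hh : ContDiffOn ℝ ((⊤ : ℕ∞) : WithTop ℕ∞) h (Ioo (1 - e) (1 + e))) {κ ρ : ℂ}
    (hκ : κ.re < 1) (hρ : -1 < ρ.re)
    (hv : ∀ w ∈ Ioo 1 (1 + e), v w = ((w - 1 : ℝ) : ℂ) ^ ρ * h w) (k : ℕ) {z : ℝ}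
    (hz : z ∈ Ioo 1 (1 + e)) :
    iteratedDeriv k (fun y : ℝ => eulerKernel (κ - 1) (y - 1) * eulerΨ κ v 0 y) z =
      ((z - 1 : ℝ) : ℂ) ^ (1 - κ + ρ - k) * branchCofactor κ ρ h k z := by
  have hz1 : 0 < z - 1 := sub_pos.mpr hz.1
  have hne : ((z - 1 : ℝ) : ℂ) ≠ 0 := by exact_mod_cast hz1.ne'
  have hz' : z ∈ Ioo (1 - e) (1 + e) := ⟨by linarith [hz.1, hz.2], hz.2⟩
  set s : ℂ := 1 - κ + ρ with hs
  -- near `z` the transform is `(y−1)^s H(y)`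
  have hloc : (fun y : ℝ => eulerKernel (κ - 1) (y - 1) * eulerΨ κ v 0 y) =ᶠ[𝓝 z]
      fun y : ℝ => ((y - 1 : ℝ) : ℂ) ^ s * branchIntegral κ ρ h 0 y := by
    filter_upwards [Ioo_mem_nhds hz.1 hz.2] with y hy
    exact eulerTransform_eq_cpow_mul_branchIntegral κ ρ hv hy
  rw [hloc.iteratedDeriv_eq]
  -- Leibniz
  have hH : ContDiffAt ℝ (k : WithTop ℕ∞) (branchIntegral κ ρ h 0) z :=
    contDiffAt_of_contDiffOn' isOpen_Ioo (contDiffOn_branchIntegral hh hκ hρ 0)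
      (by exact_mod_cast le_top) hz'
  have hP : ContDiffAt ℝ (k : WithTop ℕ∞) (fun y : ℝ => ((y - 1 : ℝ) : ℂ) ^ s) z :=
    contDiffAt_sub_one_cpow s hz.1
  have hL := iteratedDeriv_mul (n := k) (x := z) hP hH
  have hfg : ((fun y : ℝ => ((y - 1 : ℝ) : ℂ) ^ s) * branchIntegral κ ρ h 0) =
      fun y : ℝ => ((y - 1 : ℝ) : ℂ) ^ s * branchIntegral κ ρ h 0 y := rfl
  rw [hfg] at hL
  rw [hL]
  unfold branchCofactor
  rw [Finset.mul_sum]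
  refine Finset.sum_congr rfl fun i hi => ?_
  have hik : i ≤ k := Nat.lt_succ_iff.mp (Finset.mem_range.mp hi)
  rw [iteratedDeriv_sub_one_cpow s i hz.1, iteratedDeriv_branchIntegral hh hκ hρ (k - i) 0 hz',
    zero_add]
  -- `(z−1)^{s−i} = (z−1)^{s−k} (z−1)^{k−i}`
  have hsplit : ((z - 1 : ℝ) : ℂ) ^ (s - i) =
      ((z - 1 : ℝ) : ℂ) ^ (s - k) * ((z - 1 : ℝ) : ℂ) ^ (k - i) := by
    rw [← Complex.cpow_natCast, ← Complex.cpow_add _ _ hne, Nat.cast_sub hik]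
    congr 1
    ring
  rw [hsplit, hs]
  ring

/-! ### Regularity of classical solutions of Heun's equation -/

/-- `x ↦ (x : ℂ)` is smooth. [folklore] -/
private theorem contDiff_ofReal' : ContDiff ℝ ((⊤ : ℕ∞) : WithTop ℕ∞) (fun x : ℝ => (x : ℂ)) :=
  Complex.ofRealCLM.contDiff

/-- The leading coefficient `z(z−1)(z−a_H)` is smooth in the real variable. [cite: Umetsu2000, §3 (3.1)] -/
theorem contDiff_lead (aH : ℂ) : ContDiff ℝ ((⊤ : ℕ∞) : WithTop ℕ∞) (lead aH) := by
  have h : lead aH = fun x : ℝ => (x : ℂ) * ((x : ℂ) - 1) * ((x : ℂ) - aH) := rfl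
  rw [h]
  exact (contDiff_ofReal'.mul (contDiff_ofReal'.sub contDiff_const)).mul
    (contDiff_ofReal'.sub contDiff_const)

/-- The first-order coefficient is smooth in the real variable. [cite: Umetsu2000, §3 (3.1)] -/
theorem contDiff_mid (aH γ δ ε : ℂ) : ContDiff ℝ ((⊤ : ℕ∞) : WithTop ℕ∞) (mid aH γ δ ε) := by
  have h : mid aH γ δ ε = fun x : ℝ => γ * (((x : ℂ) - 1) * ((x : ℂ) - aH)) +
      δ * ((x : ℂ) * ((x : ℂ) - aH)) + ε * ((x : ℂ) * ((x : ℂ) - 1)) := rfl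
  rw [h]
  refine ((contDiff_const.mul ?_).add (contDiff_const.mul ?_)).add (contDiff_const.mul ?_)
  · exact (contDiff_ofReal'.sub contDiff_const).mul (contDiff_ofReal'.sub contDiff_const)
  · exact contDiff_ofReal'.mul (contDiff_ofReal'.sub contDiff_const)
  · exact contDiff_ofReal'.mul (contDiff_ofReal'.sub contDiff_const)

/-- The zeroth-order coefficient `αβ z + q` is smooth in the real variable. [cite: Umetsu2000, §3 (3.1)] -/
theorem contDiff_low (α β q : ℂ) : ContDiff ℝ ((⊤ : ℕ∞) : WithTop ℕ∞) (low α β q) := by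
  have h : low α β q = fun x : ℝ => α * β * (x : ℂ) + q := rfl
  rw [h]
  exact (contDiff_const.mul contDiff_ofReal').add contDiff_const

/-- **Classical solutions of Heun's equation are smooth away from the singular points.** If
`f` solves `M_z(γ,δ,ε;α,β;q) f = 0` classically on an open set `U` on which the leading
coefficient `z(z−1)(z−a_H)` does not vanish, then `f ∈ C^∞(U)` (bootstrapping
`f'' = −(mid·f' + low·f)/lead`). [cite: Umetsu2000, §3 (3.1)] -/
theorem contDiffOn_of_isSolutionOn {aH α β γ δ ε q : ℂ} {U : Set ℝ} (hU : IsOpen U)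
    (hlead : ∀ x ∈ U, lead aH x ≠ 0) {f : ℝ → ℂ} (hf : IsSolutionOn aH α β γ δ ε q U f) :
    ContDiffOn ℝ ((⊤ : ℕ∞) : WithTop ℕ∞) f U := by
  obtain ⟨f₁, f₂, hsol⟩ := hf
  -- `f₁' = F := −(mid f₁ + low f)/lead` on `U`
  set F : ℝ → ℂ := fun x => -(mid aH γ δ ε x * f₁ x + low α β q x * f x) * (lead aH x)⁻¹ with hF
  have hf₂ : ∀ x ∈ U, f₂ x = F x := by
    intro x hx
    obtain ⟨-, -, heq⟩ := hsol x hx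
    have hl := hlead x hx
    rw [hF]
    field_simp
    linear_combination heq
  have hd0 : ∀ x ∈ U, HasDerivAt f (f₁ x) x := fun x hx => (hsol x hx).1
  have hd1 : ∀ x ∈ U, HasDerivAt f₁ (F x) x := fun x hx => hf₂ x hx ▸ (hsol x hx).2.1
  have hdiff0 : DifferentiableOn ℝ f U := fun x hx => (hd0 x hx).differentiableAt.differentiableWithinAt
  have hdiff1 : DifferentiableOn ℝ f₁ U := fun x hx => (hd1 x hx).differentiableAt.differentiableWithinAt
  have hderiv0 : ∀ x ∈ U, deriv f x = f₁ x := fun x hx => (hd0 x hx).deriv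
  have hderiv1 : ∀ x ∈ U, deriv f₁ x = F x := fun x hx => (hd1 x hx).deriv
  -- bootstrapping
  have key : ∀ n : ℕ, ContDiffOn ℝ (n : WithTop ℕ∞) f U ∧ ContDiffOn ℝ (n : WithTop ℕ∞) f₁ U := by
    intro n
    induction n with
    | zero =>
      exact ⟨contDiffOn_zero.2 hdiff0.continuousOn, contDiffOn_zero.2 hdiff1.continuousOn⟩
    | succ n ih =>
      obtain ⟨ih0, ih1⟩ := ih
      have hFn : ContDiffOn ℝ (n : WithTop ℕ∞) F U := by
        have hm := (contDiff_mid aH γ δ ε).of_le (by exact_mod_cast le_top : (n : WithTop ℕ∞) ≤ _)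
        have hl := (contDiff_low α β q).of_le (by exact_mod_cast le_top : (n : WithTop ℕ∞) ≤ _)
        have hL := (contDiff_lead aH).of_le (by exact_mod_cast le_top : (n : WithTop ℕ∞) ≤ _)
        exact ((hm.contDiffOn.mul ih1).add (hl.contDiffOn.mul ih0)).neg.mul
          (hL.contDiffOn.inv hlead)
      constructor
      · have h := (contDiffOn_succ_iff_deriv_of_isOpen (𝕜 := ℝ) (n := (n : WithTop ℕ∞))
          (f := f) hU).2 ⟨hdiff0, fun h => absurd h (by simp), ih1.congr hderiv0⟩
        exact_mod_cast h
      · have h := (contDiffOn_succ_iff_deriv_of_isOpen (𝕜 := ℝ) (n := (n : WithTop ℕ∞))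
          (f := f₁) hU).2 ⟨hdiff1, fun h => absurd h (by simp), hFn.congr hderiv1⟩
        exact_mod_cast h
  exact contDiffOn_infty.2 fun n => (key n).1

/-- On `(1, a_H)` with `1 < a_H` real, the leading coefficient does not vanish. [cite: Umetsu2000, §3 (3.1)] -/
theorem lead_ne_zero_of_mem_Ioo {z₂ : ℝ} {x : ℝ} (hx : x ∈ Ioo 1 z₂) : lead (z₂ : ℂ) x ≠ 0 := by
  unfold lead
  have h0 : (x : ℂ) ≠ 0 := by exact_mod_cast (zero_lt_one.trans hx.1).ne'
  have h1 : (x : ℂ) - 1 ≠ 0 := sub_ne_zero.mpr (by exact_mod_cast hx.1.ne')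
  have h2 : (x : ℂ) - (z₂ : ℂ) ≠ 0 := sub_ne_zero.mpr (by exact_mod_cast hx.2.ne)
  exact mul_ne_zero (mul_ne_zero h0 h1) h2

/-! ### Gluing across the far endpoint -/

/-- The glued function: `v` to the left of `z₂`, `g` from `z₂` on — the smooth continuation of a
source solution past the far endpoint of the one-sided path.
[cite: Takemura2017, Proposition 1.2 (real one-sided path: the source continued smoothly past the endpoint)] -/
def glue (z₂ : ℝ) (v g : ℝ → ℂ) : ℝ → ℂ := fun w => if w < z₂ then v w else g w

/-- The glued function agrees with `v` on `(−∞, z₂)`.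
[cite: Takemura2017, Proposition 1.2 (real one-sided path: the source continued smoothly past the endpoint)] -/
theorem glue_of_lt {z₂ : ℝ} (v g : ℝ → ℂ) {w : ℝ} (hw : w < z₂) : glue z₂ v g w = v w := by
  simp [glue, hw]

/-- The glued function agrees with `g` on `[z₂, ∞)`.
[cite: Takemura2017, Proposition 1.2 (real one-sided path: the source continued smoothly past the endpoint)] -/
theorem glue_of_le {z₂ : ℝ} (v g : ℝ → ℂ) {w : ℝ} (hw : z₂ ≤ w) : glue z₂ v g w = g w := by
  simp [glue, not_lt.mpr hw]

/-- If `v = g` on `(z₂−e, z₂)`, the glued function agrees with `g` on `(z₂−e, z₂+e)`.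
[cite: Takemura2017, Proposition 1.2 (real one-sided path: the source continued smoothly past the endpoint)] -/
theorem glue_eq_right {z₂ e : ℝ} {v g : ℝ → ℂ} (hvg : ∀ w ∈ Ioo (z₂ - e) z₂, v w = g w) {w : ℝ}
    (hw : w ∈ Ioo (z₂ - e) (z₂ + e)) : glue z₂ v g w = g w := by
  by_cases h : w < z₂
  · rw [glue_of_lt v g h, hvg w ⟨hw.1, h⟩]
  · exact glue_of_le v g (not_lt.mp h)

/-- **Gluing preserves smoothness.** If `v` is smooth on `(1, z₂)`, `g` on `(z₂−e, z₂+e)`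
(`e > 0`) and `v = g` on `(z₂−e, z₂)`, then the glued function is smooth on `(1, z₂+e)`.
[cite: Takemura2017, Proposition 1.2 (real one-sided path: the source continued smoothly past the endpoint)] -/
theorem contDiffOn_glue {z₂ e : ℝ} {v g : ℝ → ℂ} (he : 0 < e)
    (hv : ContDiffOn ℝ ((⊤ : ℕ∞) : WithTop ℕ∞) v (Ioo 1 z₂))
    (hg : ContDiffOn ℝ ((⊤ : ℕ∞) : WithTop ℕ∞) g (Ioo (z₂ - e) (z₂ + e)))
    (hvg : ∀ w ∈ Ioo (z₂ - e) z₂, v w = g w) :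
    ContDiffOn ℝ ((⊤ : ℕ∞) : WithTop ℕ∞) (glue z₂ v g) (Ioo 1 (z₂ + e)) := by
  refine contDiffOn_of_locally_contDiffOn fun x hx => ?_
  by_cases hxz : x < z₂
  · refine ⟨Ioo 1 z₂, isOpen_Ioo, ⟨hx.1, hxz⟩, ?_⟩
    refine (hv.mono inter_subset_right).congr fun w hw => glue_of_lt v g hw.2.2
  · refine ⟨Ioo (z₂ - e) (z₂ + e), isOpen_Ioo, ⟨by linarith [not_lt.mp hxz], hx.2⟩, ?_⟩
    refine (hg.mono inter_subset_right).congr fun w hw => glue_eq_right hvg hw.2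

/-! ### Derivative bounds of branch type for the glued function -/

/-- For `0 < a ≤ x ≤ c` and any real exponent `p`, `min (a^p) (c^p) ≤ x^p`. [folklore] -/
private theorem min_rpow_le_rpow {a x c p : ℝ} (ha : 0 < a) (hax : a ≤ x) (hxc : x ≤ c) :
    min (a ^ p) (c ^ p) ≤ x ^ p := by
  have hx : 0 < x := ha.trans_le hax
  rcases le_or_gt 0 p with hp | hp
  · exact (min_le_left _ _).trans (Real.rpow_le_rpow ha.le hax hp)
  · exact (min_le_right _ _).trans (Real.rpow_le_rpow_of_nonpos hx hxc hp.le)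

/-- **Branch data satisfy `EulerBound`.** If `ṽ` is smooth on `(1, b)` and
`ṽ(w) = (w−1)^ρ h(w)` on `(1, 1+e)` with `h` smooth on `(1−e, 1+e)` (`e > 0`), then for every
`B < b` and every `j`, `‖ṽ⁽ʲ⁾(w)‖ ≤ C_j (w−1)^{Re ρ − j}` on `(1, B)`: near `1` by Leibniz' rule
on `(w−1)^ρ h`, away from `1` by compactness. [cite: SamkoKilbasMarichev1993, §2.5 (2.44)] -/
theorem eulerBound_of_branch {u h : ℝ → ℂ} {b e : ℝ} {ρ : ℂ} (he : 0 < e)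
    (hu : ContDiffOn ℝ ((⊤ : ℕ∞) : WithTop ℕ∞) u (Ioo 1 b))
    (hh : ContDiffOn ℝ ((⊤ : ℕ∞) : WithTop ℕ∞) h (Ioo (1 - e) (1 + e)))
    (hchart : ∀ w ∈ Ioo 1 (1 + e), u w = ((w - 1 : ℝ) : ℂ) ^ ρ * h w) {B : ℝ} (hBb : B < b) :
    EulerBound u ρ.re B := by
  intro j
  by_cases hB1 : B ≤ 1
  · exact ⟨0, fun w hw => absurd (hw.1.trans hw.2) (not_lt.mpr hB1)⟩
  rw [not_le] at hB1
  -- a uniform bound for `h, h', …, h^{(j)}` on `[1, 1 + e/2]`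
  have hK : Icc 1 (1 + e / 2) ⊆ Ioo (1 - e) (1 + e) := fun w hw => ⟨by linarith [hw.1], by linarith [hw.2]⟩
  have hMi : ∀ i, ∃ M, 0 ≤ M ∧ ∀ w ∈ Icc 1 (1 + e / 2), ‖iteratedDeriv i h w‖ ≤ M := by
    intro i
    obtain ⟨M, hM⟩ := IsCompact.exists_bound_of_continuousOn isCompact_Icc
      ((continuousOn_iteratedDeriv_of_contDiffOn' isOpen_Ioo hh i).mono hK)
    exact ⟨max M 0, le_max_right _ _, fun w hw => (hM w hw).trans (le_max_left _ _)⟩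
  choose M hM0 hM using hMi
  set A : ℝ := max 1 (B - 1) with hA
  have hA1 : 1 ≤ A := le_max_left _ _
  set C₁ : ℝ := ∑ i ∈ Finset.range (j + 1), (j.choose i : ℝ) * ‖powDerivCoeff ρ i‖ * A ^ j * M (j - i)
    with hC₁
  -- away from `1`: continuity on the compact `[1 + e/2, B]`
  obtain ⟨N, hN⟩ := IsCompact.exists_bound_of_continuousOn isCompact_Icc
    ((continuousOn_iteratedDeriv_of_contDiffOn' isOpen_Ioo hu j).mono
      (fun w hw => ⟨by linarith [hw.1], lt_of_le_of_lt hw.2 hBb⟩ : Icc (1 + e / 2) B ⊆ Ioo 1 b))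
  set m₀ : ℝ := min ((e / 2) ^ (ρ.re - (j : ℝ))) ((B - 1) ^ (ρ.re - (j : ℝ))) with hm₀
  have hm₀pos : 0 < m₀ := lt_min (Real.rpow_pos_of_pos (by linarith) _)
    (Real.rpow_pos_of_pos (by linarith) _)
  set C₂ : ℝ := max N 0 / m₀ with hC₂
  refine ⟨max C₁ C₂, fun w hw => ?_⟩
  have hw1 : 0 < w - 1 := sub_pos.mpr hw.1
  have hpow_nn : 0 ≤ (w - 1) ^ (ρ.re - (j : ℝ)) := Real.rpow_nonneg hw1.le _
  rcases lt_or_ge w (1 + e / 2) with hwe | hwe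
  · -- near `1`: Leibniz on `(w−1)^ρ h`
    have hwe' : w ∈ Ioo 1 (1 + e) := ⟨hw.1, by linarith⟩
    have hloc : u =ᶠ[𝓝 w] fun y : ℝ => ((y - 1 : ℝ) : ℂ) ^ ρ * h y := by
      filter_upwards [Ioo_mem_nhds hwe'.1 hwe'.2] with y hy using hchart y hy
    rw [hloc.iteratedDeriv_eq]
    have hP : ContDiffAt ℝ (j : WithTop ℕ∞) (fun y : ℝ => ((y - 1 : ℝ) : ℂ) ^ ρ) w :=
      contDiffAt_sub_one_cpow ρ hw.1
    have hH : ContDiffAt ℝ (j : WithTop ℕ∞) h w :=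
      contDiffAt_of_contDiffOn' isOpen_Ioo hh (by exact_mod_cast le_top) ⟨by linarith [hw.1], hwe'.2⟩
    have hL := iteratedDeriv_mul (n := j) (x := w) hP hH
    have hfg : ((fun y : ℝ => ((y - 1 : ℝ) : ℂ) ^ ρ) * h) = fun y : ℝ => ((y - 1 : ℝ) : ℂ) ^ ρ * h y := rfl
    rw [hfg] at hL
    rw [hL]
    refine (norm_sum_le _ _).trans ?_
    have hterm : ∀ i ∈ Finset.range (j + 1),
        ‖(j.choose i : ℂ) * iteratedDeriv i (fun y : ℝ => ((y - 1 : ℝ) : ℂ) ^ ρ) w *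
          iteratedDeriv (j - i) h w‖ ≤
        ((j.choose i : ℝ) * ‖powDerivCoeff ρ i‖ * A ^ j * M (j - i)) * (w - 1) ^ (ρ.re - (j : ℝ)) := by
      intro i hi
      have hij : i ≤ j := Nat.lt_succ_iff.mp (Finset.mem_range.mp hi)
      rw [iteratedDeriv_sub_one_cpow ρ i hw.1, norm_mul, norm_mul, norm_mul, Complex.norm_natCast,
        Complex.norm_cpow_eq_rpow_re_of_pos hw1]
      have hre : (ρ - (i : ℂ)).re = ρ.re - (i : ℝ) := by simp
      rw [hre]
      -- `(w−1)^{Re ρ − i} = (w−1)^{Re ρ − j} (w−1)^{j−i} ≤ (w−1)^{Re ρ − j} A^j`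
      have hsplit : (w - 1) ^ (ρ.re - (i : ℝ)) = (w - 1) ^ (ρ.re - (j : ℝ)) * (w - 1) ^ ((j : ℝ) - i) := by
        rw [← Real.rpow_add hw1]; ring_nf
      have hwA : (w - 1) ^ ((j : ℝ) - i) ≤ A ^ j := by
        rw [show ((j : ℝ) - i) = ((j - i : ℕ) : ℝ) by push_cast [Nat.cast_sub hij]; ring,
          Real.rpow_natCast]
        have hwA' : w - 1 ≤ A := (by linarith [hw.2] : w - 1 ≤ B - 1).trans (le_max_right _ _)
        calc (w - 1) ^ (j - i) ≤ A ^ (j - i) := pow_le_pow_left₀ hw1.le hwA' _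
          _ ≤ A ^ j := pow_le_pow_right₀ hA1 (Nat.sub_le j i)
      have hMw : ‖iteratedDeriv (j - i) h w‖ ≤ M (j - i) := hM (j - i) w ⟨hw.1.le, hwe.le⟩
      calc (j.choose i : ℝ) * (‖powDerivCoeff ρ i‖ * (w - 1) ^ (ρ.re - (i : ℝ))) *
            ‖iteratedDeriv (j - i) h w‖
          = (j.choose i : ℝ) * ‖powDerivCoeff ρ i‖ * (w - 1) ^ ((j : ℝ) - i) *
              ‖iteratedDeriv (j - i) h w‖ * (w - 1) ^ (ρ.re - (j : ℝ)) := by rw [hsplit]; ring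
        _ ≤ (j.choose i : ℝ) * ‖powDerivCoeff ρ i‖ * A ^ j * M (j - i) * (w - 1) ^ (ρ.re - (j : ℝ)) := by
            gcongr
    calc ∑ i ∈ Finset.range (j + 1), ‖(j.choose i : ℂ) *
            iteratedDeriv i (fun y : ℝ => ((y - 1 : ℝ) : ℂ) ^ ρ) w * iteratedDeriv (j - i) h w‖
        ≤ ∑ i ∈ Finset.range (j + 1),
            ((j.choose i : ℝ) * ‖powDerivCoeff ρ i‖ * A ^ j * M (j - i)) * (w - 1) ^ (ρ.re - (j : ℝ)) :=
          Finset.sum_le_sum hterm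
      _ = C₁ * (w - 1) ^ (ρ.re - (j : ℝ)) := by rw [hC₁, Finset.sum_mul]
      _ ≤ max C₁ C₂ * (w - 1) ^ (ρ.re - (j : ℝ)) :=
          mul_le_mul_of_nonneg_right (le_max_left _ _) hpow_nn
  · -- away from `1`
    have hNw : ‖iteratedDeriv j u w‖ ≤ max N 0 := (hN w ⟨hwe, hw.2.le⟩).trans (le_max_left _ _)
    have hm₀w : m₀ ≤ (w - 1) ^ (ρ.re - (j : ℝ)) := by
      have := min_rpow_le_rpow (p := ρ.re - (j : ℝ)) (by linarith : 0 < e / 2)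
        (by linarith : e / 2 ≤ w - 1) (by linarith [hw.2] : w - 1 ≤ B - 1)
      simpa [hm₀] using this
    calc ‖iteratedDeriv j u w‖ ≤ max N 0 := hNw
      _ = C₂ * m₀ := by rw [hC₂]; field_simp
      _ ≤ C₂ * (w - 1) ^ (ρ.re - (j : ℝ)) :=
          mul_le_mul_of_nonneg_left hm₀w (div_nonneg (le_max_right _ _) hm₀pos.le)
      _ ≤ max C₁ C₂ * (w - 1) ^ (ρ.re - (j : ℝ)) :=
          mul_le_mul_of_nonneg_right (le_max_right _ _) hpow_nn

/-! ### Smoothness of the kernel factor; transforms of functions vanishing near the base point -/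

/-- `z ↦ k_s(z−1) = (z−1)^{−s}` is smooth on `(1, ∞)`. [cite: Takemura2017, Proposition 1.2 (kernel)] -/
theorem contDiffOn_eulerKernel_shift (s : ℂ) :
    ContDiffOn ℝ ((⊤ : ℕ∞) : WithTop ℕ∞) (fun z : ℝ => eulerKernel s (z - 1)) (Ioi 1) := by
  have hlog : ContDiffOn ℝ ((⊤ : ℕ∞) : WithTop ℕ∞) (fun z : ℝ => Real.log (z - 1)) (Ioi 1) :=
    Real.contDiffOn_log.comp (contDiff_id.sub contDiff_const).contDiffOn
      fun z hz => (sub_pos.mpr (mem_Ioi.mp hz)).ne'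
  have h2 : ContDiffOn ℝ ((⊤ : ℕ∞) : WithTop ℕ∞) (fun z : ℝ => -s * ((Real.log (z - 1) : ℝ) : ℂ))
      (Ioi 1) := contDiffOn_const.mul (contDiff_ofReal'.comp_contDiffOn hlog)
  exact Complex.contDiff_exp.comp_contDiffOn h2

/-- If `g ≡ 0` on `(1, z₂)` then all its iterated derivatives vanish there. [folklore] -/
private theorem iteratedDeriv_eq_zero_of_eqOn_zero {g : ℝ → ℂ} {z₂ : ℝ}
    (h0 : ∀ w ∈ Ioo 1 z₂, g w = 0) (j : ℕ) {w : ℝ} (hw : w ∈ Ioo 1 z₂) :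
    iteratedDeriv j g w = 0 := by
  have hloc : g =ᶠ[𝓝 w] fun _ => (0 : ℂ) := by
    filter_upwards [Ioo_mem_nhds hw.1 hw.2] with y hy using h0 y hy
  rw [hloc.iteratedDeriv_eq, iteratedDeriv_const]
  simp

/-- **The transform of a function vanishing on `(1, z₂)` vanishes on `(1, z₂]`:**
`Ψ_{κ,j}[g](z) = 0` for `1 < z ≤ z₂` if `g ≡ 0` on `(1,z₂)` (the segment `(1,z)` lies in
`(1,z₂)`). [cite: Takemura2017, Proposition 1.2] -/
theorem eulerΨ_eq_zero_of_eqOn_zero {g : ℝ → ℂ} {z₂ : ℝ} (h0 : ∀ w ∈ Ioo 1 z₂, g w = 0)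
    (κ : ℂ) (j : ℕ) {z : ℝ} (hz : z ∈ Ioc 1 z₂) : eulerΨ κ g j z = 0 := by
  unfold eulerΨ
  rw [intervalIntegral.integral_of_le zero_le_one, integral_Ioc_eq_integral_Ioo]
  refine setIntegral_eq_zero_of_forall_eq_zero fun t ht => ?_
  unfold eulerΨIntegrand
  have hw : eulerPt z t ∈ Ioo 1 z₂ := by
    have h := eulerPt_mem_Ioo hz.1 ht
    exact ⟨h.1, lt_of_lt_of_le h.2 hz.2⟩
  rw [iteratedDeriv_eq_zero_of_eqOn_zero h0 j hw, mul_zero, mul_zero]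

/-- **A function vanishing near the base point satisfies `EulerBound` with every exponent.** If
`g` is smooth on `(1,b)` and `g ≡ 0` on `(1,z₂)` (`1 < z₂`), then for `B < b` and every `r`,
`‖g⁽ʲ⁾(w)‖ ≤ C_j (w−1)^{r−j}` on `(1,B)`. [cite: SamkoKilbasMarichev1993, §2.5] -/
theorem eulerBound_of_eqOn_zero {g : ℝ → ℂ} {b z₂ : ℝ} (hz₂ : 1 < z₂)
    (hg : ContDiffOn ℝ ((⊤ : ℕ∞) : WithTop ℕ∞) g (Ioo 1 b)) (h0 : ∀ w ∈ Ioo 1 z₂, g w = 0)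
    {B : ℝ} (hBb : B < b) (r : ℝ) : EulerBound g r B := by
  intro j
  by_cases hB1 : B ≤ 1
  · exact ⟨0, fun w hw => absurd (hw.1.trans hw.2) (not_lt.mpr hB1)⟩
  rw [not_le] at hB1
  obtain ⟨N, hN⟩ := IsCompact.exists_bound_of_continuousOn isCompact_Icc
    ((continuousOn_iteratedDeriv_of_contDiffOn' isOpen_Ioo hg j).mono
      (fun w hw => ⟨hz₂.trans_le hw.1, lt_of_le_of_lt hw.2 hBb⟩ : Icc z₂ B ⊆ Ioo 1 b))
  set m₀ : ℝ := min ((z₂ - 1) ^ (r - (j : ℝ))) ((B - 1) ^ (r - (j : ℝ))) with hm₀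
  have hm₀pos : 0 < m₀ := lt_min (Real.rpow_pos_of_pos (by linarith) _)
    (Real.rpow_pos_of_pos (by linarith) _)
  refine ⟨max N 0 / m₀, fun w hw => ?_⟩
  have hw1 : 0 < w - 1 := sub_pos.mpr hw.1
  have hpow_nn : 0 ≤ (w - 1) ^ (r - (j : ℝ)) := Real.rpow_nonneg hw1.le _
  have hC : 0 ≤ max N 0 / m₀ := div_nonneg (le_max_right _ _) hm₀pos.le
  rcases lt_or_ge w z₂ with hwz | hwz
  · rw [iteratedDeriv_eq_zero_of_eqOn_zero h0 j ⟨hw.1, hwz⟩, norm_zero]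
    exact mul_nonneg hC hpow_nn
  · have hNw : ‖iteratedDeriv j g w‖ ≤ max N 0 := (hN w ⟨hwz, hw.2.le⟩).trans (le_max_left _ _)
    have hm₀w : m₀ ≤ (w - 1) ^ (r - (j : ℝ)) := by
      have := min_rpow_le_rpow (p := r - (j : ℝ)) (by linarith : 0 < z₂ - 1)
        (by linarith : z₂ - 1 ≤ w - 1) (by linarith [hw.2] : w - 1 ≤ B - 1)
      simpa [hm₀] using this
    calc ‖iteratedDeriv j g w‖ ≤ max N 0 := hNw
      _ = max N 0 / m₀ * m₀ := by field_simp
      _ ≤ max N 0 / m₀ * (w - 1) ^ (r - (j : ℝ)) := mul_le_mul_of_nonneg_left hm₀w hC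

/-- **Smoothness of the derivative-regularised transform.** For `v` smooth on `(1,b)` with
`EulerBound v r B`, `B ≤ b`, `r > −1`, `Re κ < 1`: `z ↦ ∂_z^k [(z−1)^{1−κ} Ψ_{κ,0}[v](z)]` is
smooth on `(1, B)` for every `k`. [cite: Takemura2017, Proposition 1.2] -/
theorem contDiffOn_iteratedDeriv_eulerTransform {v : ℝ → ℂ} {b r B : ℝ} {κ : ℂ}
    (hv : ContDiffOn ℝ ((⊤ : ℕ∞) : WithTop ℕ∞) v (Ioo 1 b)) (hbd : EulerBound v r B) (hBb : B ≤ b)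
    (hr : -1 < r) (hκ : κ.re < 1) (k : ℕ) :
    ContDiffOn ℝ ((⊤ : ℕ∞) : WithTop ℕ∞)
      (iteratedDeriv k (fun z : ℝ => eulerKernel (κ - 1) (z - 1) * eulerΨ κ v 0 z)) (Ioo 1 B) := by
  refine contDiffOn_iteratedDeriv_of_contDiffOn' isOpen_Ioo ?_ k
  exact ((contDiffOn_eulerKernel_shift (κ - 1)).mono fun _ hy => hy.1).mul
    (contDiffOn_eulerΨ hv hbd hBb hr hκ 0)

/-- The iterated derivatives of the regularised transform form a chain of honest derivatives on
`(1,B)` (input for the polynomial lemma of `RiemannLiouvilleInjective.lean`).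
[cite: Takemura2017, Proposition 1.2] -/
theorem hasDerivAt_iteratedDeriv_eulerTransform {v : ℝ → ℂ} {b r B : ℝ} {κ : ℂ}
    (hv : ContDiffOn ℝ ((⊤ : ℕ∞) : WithTop ℕ∞) v (Ioo 1 b)) (hbd : EulerBound v r B) (hBb : B ≤ b)
    (hr : -1 < r) (hκ : κ.re < 1) (i : ℕ) {z : ℝ} (hz : z ∈ Ioo 1 B) :
    HasDerivAt (iteratedDeriv i (fun y : ℝ => eulerKernel (κ - 1) (y - 1) * eulerΨ κ v 0 y))
      (iteratedDeriv (i + 1) (fun y : ℝ => eulerKernel (κ - 1) (y - 1) * eulerΨ κ v 0 y) z) z :=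
  hasDerivAt_iteratedDeriv_of_contDiffOn' isOpen_Ioo
    (((contDiffOn_eulerKernel_shift (κ - 1)).mono fun _ hy => hy.1).mul
      (contDiffOn_eulerΨ hv hbd hBb hr hκ 0)) i hz

end GeneralHeun

end Literature.Analysis.ODE
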